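import Mathlib.NumberTheory.Real.Irrational
import Mathlib.Analysis.SpecialFunctions.Exp
import Summits.KontsevichZagierPeriods.Zeta5Search.Criteria
import Summits.KontsevichZagierPeriods.Zeta5Search.CriteriaNesterenko
import HarnessLib

/-!
# ζ(5) search — FORMAT B for SEVERAL numbers: the "one of" certificate (cell `pub-zeta5`, PROVER 3)

HONEST FRAMING: systematic search; no irrationality claim unless certified.

Criteria-side support for the cell's intermediate target **T2** ("at least one of `ζ(5), ζ(7)`
is irrational", which would improve Zudilin 2001's "one of `ζ(5), ζ(7), ζ(9), ζ(11)`", the tree's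
PROVED fact `Literature.NumberTheory.Transcendental.zudilin`). The constructions of the T2 lane
(`fam-odd`: Zudilin/Ball–Rivoal very-well-poised series with `ζ(3)` eliminated; `fam-brown9`:
Brown–Zudilin's "vanishing in the middle" cellular integral on `M_{0,10}`, whose forms live in
`1, ζ(5), ζ(7)`) deliver linear forms in `1` and a SHORT list of odd zeta values. This file types
the certificate such a family must meet, mirroring `Criteria.lean`'s `LinearFormCertificate ξ`
(criterion C1, one number) for a vector `θ : ι → ℝ` of numbers:

* `OneOfCertificate θ` — raw forms `ℓ n` with `D n · ℓ n = Φ n · (a₀ n + ∑ j, a n j · θ j)`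
  (`a₀ n, a n j ∈ ℤ`, denominators `D n ∈ ℕ⁺`, savings `Φ n ∈ ℕ⁺`), decay `|ℓ n| ≤ e^{-c n}`,
  `D n ≤ e^{δ n}`, `e^{φ n} ≤ Φ n` (all for large `n`), `ℓ n ≠ 0` infinitely often, and the
  MARGIN `δ < c + φ`; `OneOfCertificate.exists_irrational : ∃ j, Irrational (θ j)` (from the
  sibling `exists_irrational_of_scaled_linear_forms`, i.e. the tree's
  `Literature.NumberTheory.Transcendental.exists_irrational_of_integerLinearForms`,
  Zudilin 2004 §8 / Fischler, Sém. Bourbaki 910, §3.3).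
* `exists_irrational_of_lcm_linear_forms` — the same with the standard denominators
  `D n = ∏ᵢ lcm(1..cᵢ n)^{kᵢ}` and `δ = ∑ᵢ cᵢ kᵢ` supplied by the prime number theorem PROVED in
  the tree (`eventually_prod_lcmUpto_pow_le_exp`).
* Instances: `zetaFiveOrSeven_of_certificate` (`θ = (ζ(5), ζ(7))` ⇒
  `Irrational ζ(5) ∨ Irrational ζ(7)` = T2), `zetaFiveOrSeven_of_lcm_linear_forms`,
  `zetaFiveSevenNine_of_certificate` (`θ = (ζ(5), ζ(7), ζ(9))`, the intermediate "one of
  three" which would already improve Zudilin's four), and the bookkeeping implications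
  `zudilin_of_zetaFiveOrSeven`, `zudilin_of_zetaFiveSevenNine` to the tree's statement `zudilin`.

In `CRITERIA.md` units (§0): HIT ⇔ `μ₁ := c + φ − δ > 0` with `c, δ, φ` PROVEN and `ℓ n ≠ 0`
infinitely often — the same margin as C1; what changes is only the conclusion ("one of").
Everything here is PROVED; there is no named fact, no `sorry`, no closed `Prop` definition, and
no certificate is constructed: the theorems are implications `certificate ⇒ one of θ j ∉ ℚ`.
-/

noncomputable section

open Filter Topology Finset
open Literature.NumberTheory.Transcendental

namespace Summit.KontsevichZagierPeriods.Zeta5Search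

/-! ### The certificate structure for several numbers -/

/-- **FORMAT B for several numbers ("one of").** A certificate that at least one of the real
numbers `θ j` (`j : ι`, a finite index type) is irrational: raw linear forms `form n = ℓ n` with
* `arith` — `D n · ℓ n = Φ n · (a₀ n + ∑ j, a n j · θ j)` for large `n`, with integer
  coefficients `coeffConst n = a₀ n`, `coeff n j = a n j`, denominators `denom n = D n > 0` and
  savings `saving n = Φ n > 0`;
* `decay` — `|ℓ n| ≤ e^{-c n}` for large `n` (`c = decayRate`);
* `denom_le` — `D n ≤ e^{δ n}` for large `n` (`δ = denomRate`);
* `le_saving` — `e^{φ n} ≤ Φ n` for large `n` (`φ = savingRate`);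
* `nonvanishing` — `ℓ n ≠ 0` for infinitely many `n`;
* `margin_pos` — the MARGIN inequality `δ < c + φ`.
Then some `θ j` is irrational (`OneOfCertificate.exists_irrational`). For `ι = Fin 1` this is
`LinearFormCertificate (θ 0)` of `Criteria.lean`. -/
structure OneOfCertificate {ι : Type*} [Fintype ι] (θ : ι → ℝ) where
  /-- the raw linear forms `ℓ n` -/
  form : ℕ → ℝ
  /-- the common denominators `D n` -/
  denom : ℕ → ℕ
  /-- the arithmetic savings factors `Φ n` -/
  saving : ℕ → ℕ
  /-- the integer constant coefficients `a₀ n` -/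
  coeffConst : ℕ → ℤ
  /-- the integer coefficients `a n j` of the `θ j` -/
  coeff : ℕ → ι → ℤ
  /-- the decay exponent `c`: `|ℓ n| ≤ e^{-c n}` for large `n` -/
  decayRate : ℝ
  /-- the denominator exponent `δ`: `D n ≤ e^{δ n}` for large `n` -/
  denomRate : ℝ
  /-- the savings exponent `φ`: `e^{φ n} ≤ Φ n` for large `n` -/
  savingRate : ℝ
  /-- `D n > 0` -/
  denom_pos : ∀ n, 0 < denom n
  /-- `Φ n > 0` -/
  saving_pos : ∀ n, 0 < saving n
  /-- the arithmetic of the forms: `D n ℓ n = Φ n (a₀ n + ∑ j, a n j θ j)` for large `n` -/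
  arith : ∀ᶠ n : ℕ in atTop,
    (denom n : ℝ) * form n = saving n * (coeffConst n + ∑ j, (coeff n j : ℝ) * θ j)
  /-- decay: `|ℓ n| ≤ e^{-c n}` for large `n` -/
  decay : ∀ᶠ n : ℕ in atTop, |form n| ≤ Real.exp (-(decayRate * n))
  /-- denominator growth: `D n ≤ e^{δ n}` for large `n` -/
  denom_le : ∀ᶠ n : ℕ in atTop, (denom n : ℝ) ≤ Real.exp (denomRate * n)
  /-- savings growth: `e^{φ n} ≤ Φ n` for large `n` -/
  le_saving : ∀ᶠ n : ℕ in atTop, Real.exp (savingRate * n) ≤ saving n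
  /-- non-vanishing: `ℓ n ≠ 0` for infinitely many `n` -/
  nonvanishing : ∃ᶠ n : ℕ in atTop, form n ≠ 0
  /-- the margin inequality `δ < c + φ` -/
  margin_pos : denomRate < decayRate + savingRate

namespace OneOfCertificate

variable {ι : Type*} [Fintype ι] {θ : ι → ℝ}

/-- The MARGIN `c + φ - δ` of a certificate (positive by `margin_pos`): the exponential rate at
which the scaled integer forms `D n ℓ n / Φ n` still tend to `0` (`CRITERIA.md` `μ₁`). -/
def margin (cert : OneOfCertificate θ) : ℝ := cert.decayRate + cert.savingRate - cert.denomRate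

/-- The margin of a certificate is positive. -/
theorem margin_pos' (cert : OneOfCertificate θ) : 0 < cert.margin := by
  have := cert.margin_pos
  unfold margin
  linarith

/-- The scaled forms of a certificate decay at the margin rate:
`|D n ℓ n / Φ n| ≤ e^{-(c + φ - δ) n}` for all large `n`. -/
theorem eventually_abs_scaled_le (cert : OneOfCertificate θ) :
    ∀ᶠ n : ℕ in atTop, |(cert.denom n : ℝ) * cert.form n / cert.saving n| ≤
      Real.exp (-(cert.margin * n)) := by
  filter_upwards [cert.decay, cert.denom_le, cert.le_saving] with n hdec hden hsav
  have hΦ : (0 : ℝ) < cert.saving n := by exact_mod_cast cert.saving_pos n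
  have hD : (0 : ℝ) ≤ cert.denom n := by positivity
  rw [abs_div, abs_of_pos hΦ, div_le_iff₀ hΦ, abs_mul, abs_of_nonneg hD]
  calc (cert.denom n : ℝ) * |cert.form n|
      ≤ Real.exp (cert.denomRate * n) * Real.exp (-(cert.decayRate * n)) :=
        mul_le_mul hden hdec (abs_nonneg _) (Real.exp_pos _).le
    _ = Real.exp (-(cert.margin * n)) * Real.exp (cert.savingRate * n) := by
        rw [← Real.exp_add, ← Real.exp_add]
        congr 1
        simp only [margin]
        ring
    _ ≤ Real.exp (-(cert.margin * n)) * cert.saving n :=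
        mul_le_mul_of_nonneg_left hsav (Real.exp_pos _).le

/-- The scaled forms `D n ℓ n / Φ n` of a certificate tend to `0`. -/
theorem tendsto_scaled (cert : OneOfCertificate θ) :
    Tendsto (fun n : ℕ => (cert.denom n : ℝ) * cert.form n / cert.saving n) atTop (𝓝 0) := by
  have hm := cert.margin_pos'
  have h0 : Tendsto (fun n : ℕ => Real.exp (-(cert.margin * n))) atTop (𝓝 0) := by
    refine Real.tendsto_exp_atBot.comp ?_
    have h1 : Tendsto (fun n : ℕ => cert.margin * (n : ℝ)) atTop atTop :=
      (tendsto_natCast_atTop_atTop).const_mul_atTop hm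
    show Tendsto (fun n : ℕ => -(cert.margin * (n : ℝ))) atTop atBot
    exact tendsto_neg_atTop_atBot.comp h1
  refine squeeze_zero_norm' ?_ h0
  filter_upwards [cert.eventually_abs_scaled_le] with n hn
  rw [Real.norm_eq_abs]
  exact hn

/-- **Certificate ⇒ one of the `θ j` is irrational.** -/
theorem exists_irrational (cert : OneOfCertificate θ) : ∃ j, Irrational (θ j) :=
  exists_irrational_of_scaled_linear_forms θ cert.form cert.denom cert.saving cert.coeffConst
    cert.coeff cert.denom_pos cert.saving_pos cert.arith cert.tendsto_scaled cert.nonvanishing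

/-- A certificate for several numbers whose index type has ONE element is a
`LinearFormCertificate` (criterion C1) for that number. -/
def toLinearFormCertificate (cert : OneOfCertificate θ) (j₀ : ι) (hι : ∀ j, j = j₀) :
    LinearFormCertificate (θ j₀) where
  form := cert.form
  denom := cert.denom
  saving := cert.saving
  coeffConst := cert.coeffConst
  coeffXi n := cert.coeff n j₀
  decayRate := cert.decayRate
  denomRate := cert.denomRate
  savingRate := cert.savingRate
  denom_pos := cert.denom_pos
  saving_pos := cert.saving_pos
  arith := by
    have huniv : (univ : Finset ι) = {j₀} := by
      ext j; simp [hι j]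
    filter_upwards [cert.arith] with n hn
    rw [hn, huniv, sum_singleton]
  decay := cert.decay
  denom_le := cert.denom_le
  le_saving := cert.le_saving
  nonvanishing := cert.nonvanishing
  margin_pos := cert.margin_pos

end OneOfCertificate

/-! ### Denominators `∏ᵢ lcm(1..cᵢ n)^{kᵢ}`: the prime number theorem discharged -/

/-- **"One of", with `lcm` denominators (PNT discharged).** Raw forms `ℓ n` with
`(∏ᵢ d_{cᵢ n}^{kᵢ}) ℓ n = Φ n (a₀ n + ∑ j, a n j θ j)` for large `n` (`d_m = lcm(1..m)`, integer
coefficients, `Φ n ∈ ℕ⁺`), decay `|ℓ n| ≤ e^{-c n}` and savings `e^{φ n} ≤ Φ n` for large `n`,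
`ℓ n ≠ 0` infinitely often, and the margin inequality `∑ᵢ cᵢ kᵢ < c + φ`: then some `θ j` is
irrational. The denominator rate `δ = ∑ᵢ cᵢ kᵢ` is the tree's prime number theorem
(`eventually_prod_lcmUpto_pow_le_exp`); no hypothesis on primes remains. -/
theorem exists_irrational_of_lcm_linear_forms {ι : Type*} [Fintype ι] (θ : ι → ℝ) (ℓ : ℕ → ℝ)
    {m : ℕ} (c k : Fin m → ℕ) (Φ : ℕ → ℕ) (a₀ : ℕ → ℤ) (a : ℕ → ι → ℤ)
    (decayRate savingRate : ℝ) (hΦ : ∀ n, 0 < Φ n)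
    (harith : ∀ᶠ n : ℕ in atTop, (∏ i, ((Nat.lcmUpto (c i * n) : ℝ)) ^ (k i)) * ℓ n =
      Φ n * (a₀ n + ∑ j, (a n j : ℝ) * θ j))
    (hdecay : ∀ᶠ n : ℕ in atTop, |ℓ n| ≤ Real.exp (-(decayRate * n)))
    (hsaving : ∀ᶠ n : ℕ in atTop, Real.exp (savingRate * n) ≤ Φ n)
    (hne : ∃ᶠ n : ℕ in atTop, ℓ n ≠ 0)
    (hmargin : (∑ i, ((c i * k i : ℕ) : ℝ)) < decayRate + savingRate) :
    ∃ j, Irrational (θ j) := by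
  set ε : ℝ := (decayRate + savingRate - ∑ i, ((c i * k i : ℕ) : ℝ)) / 2 with hε
  have hε0 : 0 < ε := by rw [hε]; linarith
  exact OneOfCertificate.exists_irrational (θ := θ)
    { form := ℓ
      denom := fun n => ∏ i, (Nat.lcmUpto (c i * n)) ^ (k i)
      saving := Φ
      coeffConst := a₀
      coeff := a
      decayRate := decayRate
      denomRate := (∑ i, ((c i * k i : ℕ) : ℝ)) + ε
      savingRate := savingRate
      denom_pos := prod_lcmUpto_pow_pos c k
      saving_pos := hΦ
      arith := by
        filter_upwards [harith] with n hn
        push_cast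
        exact hn
      decay := hdecay
      denom_le := by
        filter_upwards [eventually_prod_lcmUpto_pow_le_exp c k hε0] with n hn
        exact_mod_cast hn
      le_saving := hsaving
      nonvanishing := hne
      margin_pos := by rw [hε]; linarith }

/-! ### The T2 lane: `θ = (ζ(5), ζ(7))` and `θ = (ζ(5), ζ(7), ζ(9))` -/

/-- **T2 — one of `ζ(5), ζ(7)` (certificate form).** A `OneOfCertificate` for the pair
`(ζ(5), ζ(7)) = ![zetaValue 5, zetaValue 7]` — linear forms in `1, ζ(5), ζ(7)` with `ζ(3)`
ELIMINATED, positive margin, non-vanishing — proves that at least one of `ζ(5), ζ(7)` is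
irrational. (No such certificate is constructed anywhere in the tree; this is the implication the
T2 lane computes its margin against. Zudilin's record in print is "one of `ζ(5), …, ζ(11)`".) -/
theorem zetaFiveOrSeven_of_certificate (cert : OneOfCertificate ![zetaValue 5, zetaValue 7]) :
    Irrational (zetaValue 5) ∨ Irrational (zetaValue 7) := by
  obtain ⟨j, hj⟩ := cert.exists_irrational
  fin_cases j
  · exact Or.inl (by simpa using hj)
  · exact Or.inr (by simpa using hj)

/-- **T2 — one of `ζ(5), ζ(7)` (`lcm` denominators, PNT discharged).** Raw forms `ℓ n` with
`(∏ᵢ d_{cᵢ n}^{kᵢ}) ℓ n = Φ n (a₀ n + a₅ n ζ(5) + a₇ n ζ(7))` for large `n` (integer coefficients,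
`Φ n ∈ ℕ⁺`), `|ℓ n| ≤ e^{-c n}` and `e^{φ n} ≤ Φ n` for large `n`, `ℓ n ≠ 0` infinitely often, and
`∑ᵢ cᵢ kᵢ < c + φ`: then `ζ(5) ∉ ℚ` or `ζ(7) ∉ ℚ`. -/
theorem zetaFiveOrSeven_of_lcm_linear_forms (ℓ : ℕ → ℝ) {m : ℕ} (c k : Fin m → ℕ) (Φ : ℕ → ℕ)
    (a₀ a₅ a₇ : ℕ → ℤ) (decayRate savingRate : ℝ) (hΦ : ∀ n, 0 < Φ n)
    (harith : ∀ᶠ n : ℕ in atTop, (∏ i, ((Nat.lcmUpto (c i * n) : ℝ)) ^ (k i)) * ℓ n =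
      Φ n * (a₀ n + a₅ n * zetaValue 5 + a₇ n * zetaValue 7))
    (hdecay : ∀ᶠ n : ℕ in atTop, |ℓ n| ≤ Real.exp (-(decayRate * n)))
    (hsaving : ∀ᶠ n : ℕ in atTop, Real.exp (savingRate * n) ≤ Φ n)
    (hne : ∃ᶠ n : ℕ in atTop, ℓ n ≠ 0)
    (hmargin : (∑ i, ((c i * k i : ℕ) : ℝ)) < decayRate + savingRate) :
    Irrational (zetaValue 5) ∨ Irrational (zetaValue 7) := by
  set θ : Fin 2 → ℝ := ![zetaValue 5, zetaValue 7] with hθ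
  have harith' : ∀ᶠ n : ℕ in atTop, (∏ i, ((Nat.lcmUpto (c i * n) : ℝ)) ^ (k i)) * ℓ n =
      Φ n * (a₀ n + ∑ j, ((![a₅ n, a₇ n] : Fin 2 → ℤ) j : ℝ) * θ j) := by
    filter_upwards [harith] with n hn
    rw [hn]
    congr 1
    simp [hθ, Fin.sum_univ_two, add_assoc]
  obtain ⟨j, hj⟩ := exists_irrational_of_lcm_linear_forms θ ℓ c k Φ a₀ (fun n => ![a₅ n, a₇ n])
    decayRate savingRate hΦ harith' hdecay hsaving hne hmargin
  fin_cases j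
  · exact Or.inl (by simpa [hθ] using hj)
  · exact Or.inr (by simpa [hθ] using hj)

/-- **One of `ζ(5), ζ(7), ζ(9)` (certificate form, `s = 9`).** A `OneOfCertificate` for
`![zetaValue 5, zetaValue 7, zetaValue 9]` (linear forms in `1, ζ(5), ζ(7), ζ(9)`, `ζ(3)`
eliminated) proves that at least one of `ζ(5), ζ(7), ζ(9)` is irrational — intermediate between
T2 and Zudilin's theorem `zudilin` (one of `ζ(5), …, ζ(11)`). Implication only. -/
theorem zetaFiveSevenNine_of_certificate
    (cert : OneOfCertificate ![zetaValue 5, zetaValue 7, zetaValue 9]) :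
    Irrational (zetaValue 5) ∨ Irrational (zetaValue 7) ∨ Irrational (zetaValue 9) := by
  obtain ⟨j, hj⟩ := cert.exists_irrational
  fin_cases j
  · exact Or.inl (by simpa using hj)
  · exact Or.inr (Or.inl (by simpa using hj))
  · exact Or.inr (Or.inr (by simpa using hj))

/-- Bookkeeping: T2 ("one of `ζ(5), ζ(7)`") implies the tree's (proved) statement `zudilin`
("one of `ζ(5), ζ(7), ζ(9), ζ(11)`") — i.e. T2 is a STRENGTHENING of the record in print. -/
theorem zudilin_of_zetaFiveOrSeven (h : Irrational (zetaValue 5) ∨ Irrational (zetaValue 7)) :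
    zudilin := by
  rcases h with h | h
  · exact Or.inl h
  · exact Or.inr (Or.inl h)

/-- Bookkeeping: "one of `ζ(5), ζ(7), ζ(9)`" implies the tree's statement `zudilin`. -/
theorem zudilin_of_zetaFiveSevenNine
    (h : Irrational (zetaValue 5) ∨ Irrational (zetaValue 7) ∨ Irrational (zetaValue 9)) :
    zudilin := by
  rcases h with h | h | h
  · exact Or.inl h
  · exact Or.inr (Or.inl h)
  · exact Or.inr (Or.inr (Or.inl h))


/-! ### From RATES to "one of" (appended by p3, 2026-08-20): the several-numbers analogue of
`Criteria.irrational_of_rates` — the designers report limits `|ℓ n|^{1/n} → α`, `log D n / n → δ₀`,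
`log Φ n / n → φ₀`; the glue lemmas of `Criteria.lean` turn them into a `OneOfCertificate`. -/

/-- **"One of" on RATES.** `D n ℓ n = Φ n (a₀ n + ∑ j, a n j θ j)` for large `n` (integer coefficients,
`D n, Φ n ∈ ℕ⁺`), `|ℓ n|^{1/n} → α > 0`, `log D n / n → δ₀`, `log Φ n / n → φ₀`, `ℓ n ≠ 0` infinitely often,
and `δ₀ + log α < φ₀` (i.e. `μ₁ = -log α + φ₀ - δ₀ > 0`): then some `θ j` is irrational. -/
theorem exists_irrational_of_rates {ι : Type*} [Fintype ι] (θ : ι → ℝ) (ℓ : ℕ → ℝ) (D Φ : ℕ → ℕ)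
    (a₀ : ℕ → ℤ) (a : ℕ → ι → ℤ) (hD : ∀ n, 0 < D n) (hΦ : ∀ n, 0 < Φ n)
    (harith : ∀ᶠ n : ℕ in atTop,
      (D n : ℝ) * ℓ n = Φ n * (a₀ n + ∑ j, (a n j : ℝ) * θ j))
    {α δ₀ φ₀ : ℝ} (hα : 0 < α)
    (hℓ : Tendsto (fun n : ℕ => |ℓ n| ^ (1 / (n : ℝ))) atTop (𝓝 α))
    (hDrate : Tendsto (fun n : ℕ => Real.log (D n) / n) atTop (𝓝 δ₀))
    (hΦrate : Tendsto (fun n : ℕ => Real.log (Φ n) / n) atTop (𝓝 φ₀))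
    (hne : ∃ᶠ n : ℕ in atTop, ℓ n ≠ 0) (hmargin : δ₀ + Real.log α < φ₀) :
    ∃ j, Irrational (θ j) := by
  set ε : ℝ := (φ₀ - δ₀ - Real.log α) / 4 with hε
  exact OneOfCertificate.exists_irrational (θ := θ)
    { form := ℓ, denom := D, saving := Φ, coeffConst := a₀, coeff := a,
      decayRate := -Real.log α - ε, denomRate := δ₀ + ε, savingRate := φ₀ - ε,
      denom_pos := hD, saving_pos := hΦ, arith := harith, nonvanishing := hne,
      decay := eventually_abs_le_exp_of_tendsto_root hα hℓ (by rw [hε]; linarith)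
      denom_le := eventually_le_exp_mul_of_tendsto_log_div
        (fun n => by exact_mod_cast hD n) hDrate (by rw [hε]; linarith)
      le_saving := eventually_exp_mul_le_of_tendsto_log_div
        (fun n => by exact_mod_cast hΦ n) hΦrate (by rw [hε]; linarith)
      margin_pos := by rw [hε]; linarith }

/-- **T2 on RATES.** Raw forms `ℓ n` with `D n ℓ n = Φ n (a₀ n + a₅ n ζ(5) + a₇ n ζ(7))` for large `n`,
`|ℓ n|^{1/n} → α > 0`, `log D n / n → δ₀`, `log Φ n / n → φ₀`, `ℓ n ≠ 0` infinitely often, and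
`δ₀ + log α < φ₀`: then `ζ(5) ∉ ℚ` or `ζ(7) ∉ ℚ`. (In `CRITERIA.md` units: `c = -log α`, margin
`μ₁ = c + φ₀ - δ₀ > 0`; implication only.) -/
theorem zetaFiveOrSeven_of_rates (ℓ : ℕ → ℝ) (D Φ : ℕ → ℕ) (a₀ a₅ a₇ : ℕ → ℤ)
    (hD : ∀ n, 0 < D n) (hΦ : ∀ n, 0 < Φ n)
    (harith : ∀ᶠ n : ℕ in atTop,
      (D n : ℝ) * ℓ n = Φ n * (a₀ n + a₅ n * zetaValue 5 + a₇ n * zetaValue 7))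
    {α δ₀ φ₀ : ℝ} (hα : 0 < α)
    (hℓ : Tendsto (fun n : ℕ => |ℓ n| ^ (1 / (n : ℝ))) atTop (𝓝 α))
    (hDrate : Tendsto (fun n : ℕ => Real.log (D n) / n) atTop (𝓝 δ₀))
    (hΦrate : Tendsto (fun n : ℕ => Real.log (Φ n) / n) atTop (𝓝 φ₀))
    (hne : ∃ᶠ n : ℕ in atTop, ℓ n ≠ 0) (hmargin : δ₀ + Real.log α < φ₀) :
    Irrational (zetaValue 5) ∨ Irrational (zetaValue 7) := by
  set θ : Fin 2 → ℝ := ![zetaValue 5, zetaValue 7] with hθ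
  have harith' : ∀ᶠ n : ℕ in atTop, (D n : ℝ) * ℓ n =
      Φ n * (a₀ n + ∑ j, ((![a₅ n, a₇ n] : Fin 2 → ℤ) j : ℝ) * θ j) := by
    filter_upwards [harith] with n hn
    rw [hn]
    congr 1
    simp [hθ, Fin.sum_univ_two, add_assoc]
  obtain ⟨j, hj⟩ := exists_irrational_of_rates θ ℓ D Φ a₀ (fun n => ![a₅ n, a₇ n]) hD hΦ harith'
    hα hℓ hDrate hΦrate hne hmargin
  fin_cases j
  · exact Or.inl (by simpa [hθ] using hj)
  · exact Or.inr (by simpa [hθ] using hj)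

end Summit.KontsevichZagierPeriods.Zeta5Search
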